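import Summits.BirchSwinnertonDyer.BirchSwinnertonDyer.Theorems.SignedLowerHalvesSmallImageLowerHalfBothSignsRttJunctionDepletion
import Summits.BirchSwinnertonDyer.BirchSwinnertonDyer.Theorems.SignedLowerHalvesSmallImageLowerHalfBothSignsRttJunctionRamified
import HarnessLib

/-!
# Route `SignedLowerHalves`, crux L `SmallImageLowerHalfBothSigns` (stmt-BirchSwinnertonDyer-23599), line `rtt_w3` v22 — E2, junction row J2⁺ / stub S1
# (THE LOCAL PACKAGE ASSEMBLED, (L1) + (L2)): THE DEPLETION `E := C(m²) · ∏_{w ∈ T} ([φ_w] − u_w)` MAPS honda's `𝐇¹ = I.H` INTO -w3's STRICT CARRIER AT `S₀ ⊆ T ∪ R`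

INPUTS hand `bsd-inputs-honda-p1` g26 under LEAD `cruxlead-stmt-BirchSwinnertonDyer-23599` g12 (cell `bsd-ssimc`; v22 stub `stub_junctionLocal_ns` = S1; RULING «S3-DEPLETION»
03:17Z: the v23 text of record for S1/S3 consumes `E` in THIS structural currency). Helper `--supports stmt-BirchSwinnertonDyer-23599`. THEOREMS ONLY: no definition, no
named fact, no instance, no `sorry`. HONEST FRAMING: the Euler-factor identity `ι E = C c′ · JunctionEuler` (third conjunct of S1, print cost «strong multiplicity one»,
RULING «S1-EULER») is NOT treated here; E2, crux L, crux M and BSD remain OPEN and are proved for NO curve.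

* ★★★ `junctionDepletion_smul_mem_strictCarrier` — for a finite set `T` of places OFF `P` with Frobenius elements `φ_w` and exponents `x_w` ((L1), file `…RttJunctionDepletion`),
  a set `R` of places `w ∤ p` that are RAMIFIED for `θ′` with a common exponent `m` of `θ′` on their inertia ((L2), file `…RttJunctionRamified`), and ANY `S₀ ⊆ T ∪ R`:
  `(C(m²) · ∏_{w∈T} ((1+T)^{x_w} − C u(φ_w))) • b ∈ strictCarrier I (strictLevel S κ θ′ P S₀) _` for EVERY `b ∈ I.H`.
* ★★★ `exists_junctionDepletion_smul_mem_strictCarrier` — packaged with the Frobenius elements / exponents chosen (`κ γ` a unit).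
References: [PerrinRiou1994Invent] §1.3; [Rubin2000] Thm. 1.7.3, App. B.2–B.3; [NeukirchSchmidtWingberg2008] (8.6.2)–(8.6.3); [SerreLocalFields1979] VII §5.
-/

set_option autoImplicit false
set_option linter.dupNamespace false -- D-0017: single-problem summit, the namespace repeats the problem name by design
noncomputable section

open scoped Classical
open NumberField IsDedekindDomain Field PowerSeries

namespace Summit.BirchSwinnertonDyer.BirchSwinnertonDyer.Theorems.SmallImageRttJunctionLocal

open Literature.NumberTheory.EllipticCurves Literature.NumberTheory.GaloisRepresentations
  Literature.NumberTheory.ComplexMultiplication.EllipticUnits Literature.NumberTheory.ComplexMultiplication.EllipticUnits.JohnsonLeungKings2011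
  Summit.BirchSwinnertonDyer.BirchSwinnertonDyer.Theorems.SmallImageRttD2J1 Summit.BirchSwinnertonDyer.BirchSwinnertonDyer.Theorems.SmallImageRttD2Seq
  IsDedekindDomain.HeightOneSpectrum

section Junction

variable {K : Type} [Field K] [NumberField K] {p : ℕ} [Fact p.Prime] (S : Set (PadicAlgCl p)) (κ : ZpExtension K p) {γ : absoluteGaloisGroup K}
  (θ' : absoluteGaloisGroup K →ₜ* (padicCoeffIntegers S)ˣ) (P : Set (HeightOneSpectrum (𝓞 K)))

/-- At a `θ′`-ramified place `w ∤ p` with exponent `m`, `loc_w ∘ conj_δ` kills the level components of `(C(m²) · F) • b` for ANY `F ∈ Λ_𝒪` and any `b ∈ I.H`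
(`proj (C c • z) = c • proj z`, scalars commute with `conj_δ`, and `m²` kills the localisation of every level class: file `…RttJunctionRamified`).
[cite: Rubin2000, App. B.2] [cite: SerreLocalFields1979, VII §5] -/
theorem locNK_cycLayerConjO_proj_C_natCast_sq_mul_smul {w : HeightOneSpectrum (𝓞 K)} (hwp : ((p : ℕ) : 𝓞 K) ∉ w.asIdeal)
    (hR : ∃ 𝔓 ∈ w.primesAbove, ∃ τ ∈ 𝔓.inertia (absoluteGaloisGroup K), θ' τ ≠ 1)
    {m : ℕ} (hθm : ∀ 𝔓 ∈ w.primesAbove, ∀ τ ∈ 𝔓.inertia (absoluteGaloisGroup K), θ' τ ^ m = 1)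
    (I : CycIwasawaCohomologyDataO S κ γ θ' P 1) (F : IwasawaAlgebraO S) (b : I.H) (n k : ℕ) (δ : absoluteGaloisGroup K) :
    locNK S κ θ' P w n k (cycLayerConjO S κ θ' P n k 1 δ (I.proj n k ((PowerSeries.C ((m : padicCoeffIntegers S) ^ 2) * F) • b))) = 0 := by
  rw [mul_smul, I.proj_C_smul, cycLayerConjO_cycLayerScalarO]
  exact locNK_cycLayerScalarO_natCast_sq_eq_zero_of_ramified S κ θ' P w hwp hR hθm n k _

/-- ★★★ **THE JUNCTION DEPLETION MAPS `𝐇¹` INTO THE STRICT CARRIER AT ALL OF `S₀ ⊆ T ∪ R`** (the structural content of the LEAD's stub S1 «`∀ b, E • b ∈ B′`», (L1) + (L2)):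
for a finite set `T` of places OFF `P` with Frobenius elements `φ_w` (at the primes cut out by the chosen embeddings) and exponents `x_w` (`γ^{x_w mod pⁿ} φ_w⁻¹ ∈ U_n`), a set `R`
of places `w ∤ p` RAMIFIED for `θ′` (some inertia element above `w` not killed) on whose inertia `θ′` has the common exponent `m`, and every `S₀ ⊆ T ∪ R`:
`(C(m²) · ∏_{w ∈ T} ((1+T)^{x_w} − C u(φ_w))) • b ∈ strictCarrier I (strictLevel S κ θ′ P S₀) _` for EVERY `b ∈ I.H` — at `w ∈ T` the factor `P_w` kills
(`locNK_cycLayerConjO_proj_frobDepletion_smul`), at `w ∈ R` the constant `m²` does (`locNK_cycLayerConjO_proj_C_natCast_sq_mul_smul`).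
[cite: PerrinRiou1994Invent, §1.3] [cite: Rubin2000, Thm. 1.7.3, App. B.2–B.3] [cite: NeukirchSchmidtWingberg2008, (8.6.2)–(8.6.3)] -/
theorem junctionDepletion_smul_mem_strictCarrier (T : Finset (HeightOneSpectrum (𝓞 K))) (hT : ∀ w ∈ T, w ∉ P)
    (hNP : ∀ n, ramificationSubgroup K P ≤ κ.layerSubgroup n)
    (φ : HeightOneSpectrum (𝓞 K) → absoluteGaloisGroup K) (hφ : ∀ w ∈ T, IsArithFrobAt (𝓞 K) (φ w) (adicCompletionPrime K w))
    (x : HeightOneSpectrum (𝓞 K) → ℤ_[p]) (hx : ∀ w ∈ T, ∀ n, γ ^ (PadicInt.toZModPow n (x w)).val * (φ w)⁻¹ ∈ κ.layerSubgroup n)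
    (R : Set (HeightOneSpectrum (𝓞 K))) (hRp : ∀ w ∈ R, ((p : ℕ) : 𝓞 K) ∉ w.asIdeal)
    (hRR : ∀ w ∈ R, ∃ 𝔓 ∈ w.primesAbove, ∃ τ ∈ 𝔓.inertia (absoluteGaloisGroup K), θ' τ ≠ 1)
    {m : ℕ} (hRm : ∀ w ∈ R, ∀ 𝔓 ∈ w.primesAbove, ∀ τ ∈ 𝔓.inertia (absoluteGaloisGroup K), θ' τ ^ m = 1)
    (I : CycIwasawaCohomologyDataO S κ γ θ' P 1) (S₀ : Set (HeightOneSpectrum (𝓞 K))) (hS₀ : S₀ ⊆ ↑T ∪ R)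
    (hStr : ∀ (n k : ℕ) (f : IwasawaAlgebraO S) (y : cycLayerCohO S κ θ' P n k 1), y ∈ strictLevel S κ θ' P S₀ n k →
      (letI := cycLayerModuleO S κ γ θ' P (show 1 ≤ 2 by norm_num) n k; f • y) ∈ strictLevel S κ θ' P S₀ n k)
    (b : I.H) :
    (PowerSeries.C ((m : padicCoeffIntegers S) ^ 2) * ∏ w ∈ T, (iwasawaToIwasawaO S (binomialSeries ℤ_[p] (x w)) -
        PowerSeries.C (((θ' (φ w) : (padicCoeffIntegers S)ˣ) : padicCoeffIntegers S) *
          padicIntToCoeffIntegers S ((GaloisRep.cyclotomicCharacter K p (φ w) : ℤ_[p]ˣ) : ℤ_[p])))) • b ∈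
      strictCarrier I (strictLevel S κ θ' P S₀) hStr := by
  refine (mem_strictCarrier_strictLevel_iff S I S₀ _).mpr fun n k w hw δ ↦ ?_
  rcases hS₀ hw with hwT | hwR
  · rw [← Finset.mul_prod_erase T _ (Finset.mem_coe.mp hwT), mul_left_comm, mul_smul]
    exact locNK_cycLayerConjO_proj_frobDepletion_smul S κ θ' P (hT w (Finset.mem_coe.mp hwT)) hNP (hφ w (Finset.mem_coe.mp hwT)) I
      (hx w (Finset.mem_coe.mp hwT)) _ n k δ
  · exact locNK_cycLayerConjO_proj_C_natCast_sq_mul_smul S κ θ' P (hRp w hwR) (hRR w hwR) (hRm w hwR) I _ b n k δ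

/-- ★★★ **Packaged: for `κ γ` a unit of `ℤ_p`, a finite set `T` of places off `P` and a set `R` of `θ′`-ramified places off `p` with exponent `m`, THERE ARE Frobenius
elements `φ_w` and exponents `x_w` whose depletion `C(m²) · ∏_{w∈T} ((1+T)^{x_w} − C u(φ_w))` maps EVERY `b ∈ 𝐇¹` into the strict carrier at every `S₀ ⊆ T ∪ R`.**
This is the `E` of the v23 text of record for S1/S3 (`g`-free; `λ(Λ_𝒪/(E))` by `normLambda_binomialSeries_sub_one`). [cite: PerrinRiou1994Invent, §1.3] [cite: Rubin2000, Thm. 1.7.3, App. B.2–B.3] -/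
theorem exists_junctionDepletion_smul_mem_strictCarrier {a : ℤ_[p]ˣ} (hγ : (κ γ).toAdd = a) (T : Finset (HeightOneSpectrum (𝓞 K)))
    (hT : ∀ w ∈ T, w ∉ P) (hNP : ∀ n, ramificationSubgroup K P ≤ κ.layerSubgroup n)
    (R : Set (HeightOneSpectrum (𝓞 K))) (hRp : ∀ w ∈ R, ((p : ℕ) : 𝓞 K) ∉ w.asIdeal)
    (hRR : ∀ w ∈ R, ∃ 𝔓 ∈ w.primesAbove, ∃ τ ∈ 𝔓.inertia (absoluteGaloisGroup K), θ' τ ≠ 1)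
    {m : ℕ} (hRm : ∀ w ∈ R, ∀ 𝔓 ∈ w.primesAbove, ∀ τ ∈ 𝔓.inertia (absoluteGaloisGroup K), θ' τ ^ m = 1)
    (I : CycIwasawaCohomologyDataO S κ γ θ' P 1) :
    ∃ (φ : HeightOneSpectrum (𝓞 K) → absoluteGaloisGroup K) (x : HeightOneSpectrum (𝓞 K) → ℤ_[p]),
      (∀ w ∈ T, IsArithFrobAt (𝓞 K) (φ w) (adicCompletionPrime K w)) ∧
      (∀ w ∈ T, ∀ n, γ ^ (PadicInt.toZModPow n (x w)).val * (φ w)⁻¹ ∈ κ.layerSubgroup n) ∧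
      (∀ w, x w = ((a⁻¹ : ℤ_[p]ˣ) : ℤ_[p]) * (κ (φ w)).toAdd) ∧
      ∀ (S₀ : Set (HeightOneSpectrum (𝓞 K))) (_ : S₀ ⊆ ↑T ∪ R)
        (hStr : ∀ (n k : ℕ) (f : IwasawaAlgebraO S) (y : cycLayerCohO S κ θ' P n k 1), y ∈ strictLevel S κ θ' P S₀ n k →
          (letI := cycLayerModuleO S κ γ θ' P (show 1 ≤ 2 by norm_num) n k; f • y) ∈ strictLevel S κ θ' P S₀ n k) (b : I.H),
        (PowerSeries.C ((m : padicCoeffIntegers S) ^ 2) * ∏ w ∈ T, (iwasawaToIwasawaO S (binomialSeries ℤ_[p] (x w)) -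
            PowerSeries.C (((θ' (φ w) : (padicCoeffIntegers S)ˣ) : padicCoeffIntegers S) *
              padicIntToCoeffIntegers S ((GaloisRep.cyclotomicCharacter K p (φ w) : ℤ_[p]ˣ) : ℤ_[p])))) • b ∈
          strictCarrier I (strictLevel S κ θ' P S₀) hStr := by
  have hF : ∀ w : HeightOneSpectrum (𝓞 K), ∃ φ : absoluteGaloisGroup K, IsArithFrobAt (𝓞 K) φ (adicCompletionPrime K w) := fun w ↦
    IsDedekindDomain.HeightOneSpectrum.exists_isArithFrobAt_of_mem_primesAbove_holds (adicCompletionPrime_mem_primesAbove K w)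
  choose φ hφ using hF
  refine ⟨φ, fun w ↦ ((a⁻¹ : ℤ_[p]ˣ) : ℤ_[p]) * (κ (φ w)).toAdd, fun w _ ↦ hφ w,
    fun w _ n ↦ pow_toZModPow_val_mul_inv_mem_layerSubgroup hγ (φ w) n, fun _ ↦ rfl, fun S₀ hS₀ hStr b ↦ ?_⟩
  exact junctionDepletion_smul_mem_strictCarrier S κ θ' P T hT hNP φ (fun w _ ↦ hφ w) _
    (fun w _ n ↦ pow_toZModPow_val_mul_inv_mem_layerSubgroup hγ (φ w) n) R hRp hRR hRm I S₀ hS₀ hStr b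

end Junction

end Summit.BirchSwinnertonDyer.BirchSwinnertonDyer.Theorems.SmallImageRttJunctionLocal

end
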